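import Summits.Langlands.Langlands.Theorems.IrreducibilityBySelfDualityReciprocityUpToIrreducibilityCorrespondsConj
import Summits.Langlands.Langlands.Theorems.IrreducibilityBySelfDualityIrreducibleOffSectorOfReciprocity
import Literature.NumberTheory.Automorphic.LocalComponentBJUniqueProofs
import Literature.FieldTheory.AlgClosed.PadicAlgClEquivComplex
import Literature.NumberTheory.GaloisRepresentations.WeilDeligneOfGaloisProofs
import Literature.NumberTheory.GaloisRepresentations.WeilDeligneRepFrobSemisimpleProofs
import Summits.Langlands.Langlands.Theses.IrreducibilityBySelfDuality
import HarnessLib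

/-!
# Tightness of line `Sketch` for the crux `ReciprocityUpToIrreducibility` (item stmt-Langlands-14328), III:
# the crux implies the gluing-shaped stub `stub_pairCompatibilityAbove`, modulo Arthur–Clozel (2.2)–(2.3)

Support file (closes nothing; continuation lead c2).  The registered open stub
`stub_pairCompatibilityAbove` of line `Sketch` reads: for EVERY reciprocity datum `Rec` that is
locally–globally compatible AWAY from `ℓ` for all irreducible pinned-geometric pairs `(π, ρ)` (all
ranks, all primes), compatibility also holds at the places ABOVE `ℓ`.  Unlike W, B_w, LGC-away it is
not implied by the crux `E` by inspection (`E` speaks of its own datum `Rec₀` only).  This file derives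
it from `E` granted the two analytic facts the line already assumes (route input AC (2.2) and the stub
AC (2.3), used only to know that `E`'s direction-(A') avatars are irreducible,
`IrreducibleOffSector.isIrreducible_of_reciprocityUpToIrreducibility`):

* at the place `v ∣ ℓ`, the crux gives compatibility for `Rec₀` and the given `ρ` (weak-to-strong,
  `corresponds_of_exists_corresponds`); the Weil–Deligne side of the clause does not mention `Rec`, so
  it remains to see that `Rec.llc v` and `Rec₀.llc v` take the same value on the local component
  `π_v` (`recGL_eq_of_away`);
* for that, read both data at `v` through a prime `ℓ' ≠ char v` (`exists_prime_natCast_not_mem`):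
  the away-hypothesis for `Rec` and the crux for `Rec₀`, applied to `E`'s irreducible avatar
  `ρ₁ : Γ_K → GL_n(ℚ̄_{ℓ'})` of `π`, give two Weil–Deligne representations attached to `ρ₁|_{W_v}` by
  the Grothendieck–Deligne recipe — isomorphic by the proved independence of choices
  (`IsWeilDeligneOfLadic.isEquivalent_holds`) —, hence isomorphic complex transports
  (`isEquivalent_of_isTransportAlong`), hence ONE Frobenius-semisimple class
  (`hasFrobSemisimpleClass_unique` + `hasFrobSemisimpleClass_of_isEquivalent`), which is both
  `(Rec.llc v).recGL n [π_v]` and `(Rec₀.llc v).recGL n [π_v]` (local components are unique up to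
  isomorphism, `hasLocalComponentAt_unique_holds`).

With `…Tightness.lean` (W, B_w, LGC-away) and `…TightnessFM.lean` (lang.S03) this makes the decoupling
of line `Sketch` an equivalence stub by stub: modulo AC (2.2)–(2.3) every open stub except the
Literature debt `stub_jsPole` is implied by the crux.  No definitions; std axioms.
-/

noncomputable section

set_option linter.dupNamespace false -- project-wide option (lakefile weak.linter.dupNamespace); `Summit.Langlands.Langlands` is the mandated namespace

open scoped MatrixGroups Matrix NumberField Classical
open Filter IsDedekindDomain Field
open Literature.NumberTheory.Automorphic Literature.NumberTheory.GaloisRepresentations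
open Summit.Langlands
open Summit.Langlands.Langlands.Theses.IrreducibilityBySelfDuality

namespace Summit.Langlands.Langlands.Theorems.ReciprocityUpToIrreducibility

/-! ## 1. Two more invariance facts on Weil–Deligne representations -/

section WD

variable {F : Type} [Field F] [ValuativeRel F] [TopologicalSpace F] [IsNonarchimedeanLocalField F]
  {n : ℕ}

/-- **Transport along `ι` preserves isomorphism**: if `r ≅ r'` over `E` and `s, s'` are `r, r'`
transported along `ι : E →+* C`, then `s ≅ s'` (the matrix of the isomorphism, mapped by `ι`,
intertwines). [cite: DeligneAntwerpII1973, §8.4.3] -/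
theorem isEquivalent_of_isTransportAlong {E : Type*} [Field E] [CharZero E] {C : Type*} [Field C]
    [CharZero C] (ι : E →+* C) {r r' : WeilDeligneRep F E (Fin n → E)}
    {s s' : WeilDeligneRep F C (Fin n → C)} (h : r.IsEquivalent r') (hs : r.IsTransportAlong ι s)
    (hs' : r'.IsTransportAlong ι s') : s.IsEquivalent s' := by
  obtain ⟨eqv⟩ := h
  set e : (Fin n → E) ≃ₗ[E] (Fin n → E) := eqv.toRepEquiv.toLinearEquiv with he
  set M : Matrix (Fin n) (Fin n) E := LinearMap.toMatrix' (e : (Fin n → E) →ₗ[E] (Fin n → E))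
  set M' : Matrix (Fin n) (Fin n) E := LinearMap.toMatrix' (e.symm : (Fin n → E) →ₗ[E] (Fin n → E))
  have hMM' : M * M' = 1 := by
    rw [← LinearMap.toMatrix'_comp, LinearEquiv.comp_symm, LinearMap.toMatrix'_id]
  have hM'M : M' * M = 1 := by
    rw [← LinearMap.toMatrix'_comp, LinearEquiv.symm_comp, LinearMap.toMatrix'_id]
  -- the intertwining relations of `e`, as matrix identities
  have hρ : ∀ w, M * LinearMap.toMatrix' (r.ρ w) = LinearMap.toMatrix' (r'.ρ w) * M := fun w => by
    rw [← LinearMap.toMatrix'_comp, ← LinearMap.toMatrix'_comp]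
    exact congrArg LinearMap.toMatrix' (eqv.toRepEquiv.toIntertwiningMap.isIntertwining' w)
  have hN : M * LinearMap.toMatrix' r.N = LinearMap.toMatrix' r'.N * M := by
    rw [← LinearMap.toMatrix'_comp, ← LinearMap.toMatrix'_comp]
    exact congrArg LinearMap.toMatrix' eqv.comm_N
  -- mapped by `ι`
  have h1 : M'.map ι * M.map ι = 1 := by rw [← Matrix.map_mul, hM'M, Matrix.map_one _ ι.map_zero ι.map_one]
  have h2 : M.map ι * M'.map ι = 1 := by rw [← Matrix.map_mul, hMM', Matrix.map_one _ ι.map_zero ι.map_one]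
  let e' : (Fin n → C) ≃ₗ[C] (Fin n → C) := Matrix.toLin'OfInv h1 h2
  have he' : (e' : (Fin n → C) →ₗ[C] (Fin n → C)) = Matrix.toLin' (M.map ι) := LinearMap.ext fun _ => rfl
  have hint : ∀ w, (e' : (Fin n → C) →ₗ[C] (Fin n → C)) ∘ₗ s.ρ w =
      s'.ρ w ∘ₗ (e' : (Fin n → C) →ₗ[C] (Fin n → C)) := fun w => by
    refine LinearMap.toMatrix'.injective ?_
    rw [LinearMap.toMatrix'_comp, LinearMap.toMatrix'_comp, he', LinearMap.toMatrix'_toLin',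
      hs.1 w, hs'.1 w, ← Matrix.map_mul, hρ w, Matrix.map_mul]
  have hintN : (e' : (Fin n → C) →ₗ[C] (Fin n → C)) ∘ₗ s.N =
      s'.N ∘ₗ (e' : (Fin n → C) →ₗ[C] (Fin n → C)) := by
    refine LinearMap.toMatrix'.injective ?_
    rw [LinearMap.toMatrix'_comp, LinearMap.toMatrix'_comp, he', LinearMap.toMatrix'_toLin',
      hs.2, hs'.2, ← Matrix.map_mul, hN, Matrix.map_mul]
  exact ⟨{ toRepEquiv := Representation.Equiv.mk e' hint, comm_N := hintN }⟩

/-- **The Frobenius-semisimple class of a complex Weil–Deligne representation is well defined**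
(uniqueness of the Frobenius-semisimplification, proved in the tree). [cite: DeligneAntwerpII1973, §8.6] -/
theorem hasFrobSemisimpleClass_unique {r : WeilDeligneRep F ℂ (Fin n → ℂ)}
    {c c' : Quotient (frobSemisimpleWDSetoid F n)} (h : r.HasFrobSemisimpleClass c)
    (h' : r.HasFrobSemisimpleClass c') : c = c' := by
  obtain ⟨s, hs, rfl⟩ := h
  obtain ⟨s', hs', rfl⟩ := h'
  obtain rfl : s = s' :=
    (WeilDeligneRep.existsUnique_frobSemisimplification_holds (C := ℂ) (V := Fin n → ℂ) r).unique hs hs'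
  rfl

end WD

/-! ## 2. Reading a local Langlands datum through a prime away from the place -/

section Summit

variable {K : Type} [Field K] [NumberField K]

omit [NumberField K] in
/-- Every finite place misses some rational prime (`2` or `3`). [folklore] -/
theorem exists_prime_natCast_not_mem (v : HeightOneSpectrum (𝓞 K)) :
    ∃ (ℓ' : ℕ) (_ : Fact ℓ'.Prime), ((ℓ' : ℕ) : 𝓞 K) ∉ v.asIdeal := by
  by_cases h2 : ((2 : ℕ) : 𝓞 K) ∈ v.asIdeal
  · refine ⟨3, ⟨Nat.prime_three⟩, fun h3 => v.isPrime.ne_top ((Ideal.eq_top_iff_one _).2 ?_)⟩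
    have h := v.asIdeal.sub_mem h3 h2
    have h1 : ((3 : ℕ) : 𝓞 K) - ((2 : ℕ) : 𝓞 K) = 1 := by push_cast; norm_num
    rwa [h1] at h
  · exact ⟨2, ⟨Nat.prime_two⟩, h2⟩

variable {n : ℕ} {hcpt : isCompact_glFiniteIntegralLevel n K}

/-- **Two reciprocity data that are both locally–globally compatible (away from the residue
characteristics of their primes) with ONE pair `(π, ρ₁)` at `v` agree on the local component of `π`
at `v`.**  Both attach to `ρ₁|_{W_v}` a Weil–Deligne representation by the Grothendieck–Deligne recipe
(isomorphic: independence of choices), transport it to `ℂ` (isomorphic transports), and name its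
Frobenius-semisimple class (well defined, isomorphism invariant) as `rec_v` of a local component of
`π` at `v` (unique up to isomorphism). [cite: DeligneAntwerpII1973, §8.4.2] -/
theorem recGL_eq_of_localGlobalCompatibleAt (Rec Rec₀ : ReciprocityData K) {ℓ' : ℕ} [Fact ℓ'.Prime]
    (ι' : PadicAlgCl ℓ' ≃+* ℂ) (π : AutomorphicRepData (AutomorphyDatum.gl n K hcpt))
    (ρ₁ : FramedGaloisRep K (PadicAlgCl ℓ') n) {v : HeightOneSpectrum (𝓞 K)}
    (hv : ((ℓ' : ℕ) : 𝓞 K) ∉ v.asIdeal) (h : LocalGlobalCompatibleAt Rec ι' π ρ₁ v)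
    (h₀ : LocalGlobalCompatibleAt Rec₀ ι' π ρ₁ v)
    (πv : SmoothIrrep (GL (Fin n) (v.adicCompletion K))) (hπv : π.HasLocalComponentAt v πv.ρ) :
    (Rec.llc v).recGL n (IrrClass.mk πv) = (Rec₀.llc v).recGL n (IrrClass.mk πv) := by
  obtain ⟨πv₁, r₁, rℂ₁, hπv₁, hlad₁, -, htr₁, hcls₁⟩ := h
  obtain ⟨πv₂, r₂, rℂ₂, hπv₂, hlad₂, -, htr₂, hcls₂⟩ := h₀
  have e₁ : IrrClass.mk πv₁ = IrrClass.mk πv :=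
    AutomorphicRepData.hasLocalComponentAt_unique_holds π v πv₁ πv hπv₁ hπv
  have e₂ : IrrClass.mk πv₂ = IrrClass.mk πv :=
    AutomorphicRepData.hasLocalComponentAt_unique_holds π v πv₂ πv hπv₂ hπv
  rw [e₁] at hcls₁
  rw [e₂] at hcls₂
  have hr : r₁.IsEquivalent r₂ :=
    IsWeilDeligneOfLadic.isEquivalent_holds _ r₁ r₂ (hlad₁ hv) (hlad₂ hv)
  have hrℂ : rℂ₁.IsEquivalent rℂ₂ := isEquivalent_of_isTransportAlong _ hr htr₁ htr₂
  exact hasFrobSemisimpleClass_unique (hasFrobSemisimpleClass_of_isEquivalent hrℂ hcls₁) hcls₂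

/-- **The crux implies the registered open stub `stub_pairCompatibilityAbove` (verbatim), granted
Arthur–Clozel (2.2)–(2.3).**  Let `E` hold with datum `Rec₀` over `K`, and let `Rec` be locally–globally
compatible away from `ℓ` for all irreducible pinned-geometric pairs.  For such a pair `(π, ρ)` and
`v ∣ ℓ`: the crux's compatibility of `(π, ρ)` at `v` for `Rec₀` (weak-to-strong upgrade) is the wanted
clause except that it names `(Rec₀.llc v).recGL n [π_v]`; reading both data at `v` through a prime
`ℓ' ∤ v` on `E`'s irreducible (AC (2.2)–(2.3)) `ℓ'`-adic avatar of `π` shows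
`(Rec.llc v).recGL n [π_v] = (Rec₀.llc v).recGL n [π_v]`. [cite: DeligneAntwerpII1973, §8.4.2] -/
theorem pairCompatibilityAbove_of_reciprocityUpToIrreducibility
    (h22 : JacquetShalika1981_partialPairL_boundary_repData)
    (h23 : JacquetShalika1981_partialPairL_pole_repData) (hE : ReciprocityUpToIrreducibility) :
    ∀ (K : Type) [Field K] [NumberField K] (Rec : ReciprocityData K),
      (∀ (n : ℕ) (hcpt : isCompact_glFiniteIntegralLevel n K), 0 < n →
        ∀ (π : CuspidalAutomorphicRepData n K hcpt), π.1.IsLAlgebraic →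
          ∀ (ℓ : ℕ) [Fact ℓ.Prime] (ι : PadicAlgCl ℓ ≃+* ℂ) (ρ : FramedGaloisRep K (PadicAlgCl ℓ) n),
            ρ.toGaloisRep.IsIrreducible →
            ((∀ᶠ v : HeightOneSpectrum (𝓞 K) in cofinite, ρ.IsUnramifiedAt v) ∧
              ∀ (v : HeightOneSpectrum (𝓞 K)) (hv : ((ℓ : ℕ) : 𝓞 K) ∈ v.asIdeal),
                (Literature.NumberTheory.PAdicHodge.fontainePstAdicCompletion v ℓ hv).IsDeRhamFramed
                  (ρ.toLocal v)) →
              (∀ᶠ v : HeightOneSpectrum (𝓞 K) in cofinite, SatakeFrobCompatibleAt ι π.1 ρ v) →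
                ∀ v : HeightOneSpectrum (𝓞 K), ((ℓ : ℕ) : 𝓞 K) ∉ v.asIdeal →
                  LocalGlobalCompatibleAt Rec ι π.1 ρ v) →
      ∀ (n : ℕ) (hcpt : isCompact_glFiniteIntegralLevel n K), 0 < n →
        ∀ (π : CuspidalAutomorphicRepData n K hcpt), π.1.IsLAlgebraic →
          ∀ (ℓ : ℕ) [Fact ℓ.Prime] (ι : PadicAlgCl ℓ ≃+* ℂ) (ρ : FramedGaloisRep K (PadicAlgCl ℓ) n),
            ρ.toGaloisRep.IsIrreducible →
            ((∀ᶠ v : HeightOneSpectrum (𝓞 K) in cofinite, ρ.IsUnramifiedAt v) ∧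
              ∀ (v : HeightOneSpectrum (𝓞 K)) (hv : ((ℓ : ℕ) : 𝓞 K) ∈ v.asIdeal),
                (Literature.NumberTheory.PAdicHodge.fontainePstAdicCompletion v ℓ hv).IsDeRhamFramed
                  (ρ.toLocal v)) →
              (∀ᶠ v : HeightOneSpectrum (𝓞 K) in cofinite, SatakeFrobCompatibleAt ι π.1 ρ v) →
                ∀ v : HeightOneSpectrum (𝓞 K), ((ℓ : ℕ) : 𝓞 K) ∈ v.asIdeal →
                  LocalGlobalCompatibleAt Rec ι π.1 ρ v := by
  intro K _ _ Rec hAway n hcpt hn π hL ℓ _ ι ρ hirr _ hρ v hv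
  obtain ⟨Rec₀, hRec₀⟩ := hE K
  -- the crux's compatibility at `v` for `Rec₀` and the given `ρ`
  obtain ⟨hA, -⟩ := hRec₀ n hn hcpt
  obtain ⟨ρ', -, hcorr'⟩ := hA π hL ℓ ι
  have hc : Corresponds Rec₀ ι π.1 ρ := corresponds_of_exists_corresponds hirr hρ ⟨ρ', hcorr'⟩
  obtain ⟨πv, r, rℂ, hπv, -, hpst, htr, hcls⟩ := hc.2 v
  -- a prime away from `v`, and `E`'s irreducible avatar of `π` there
  obtain ⟨ℓ', _, hℓ'⟩ := exists_prime_natCast_not_mem v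
  obtain ⟨ι'⟩ := PadicAlgCl.nonempty_ringEquiv_complex ℓ'
  obtain ⟨ρ₁, hgeo₁, hcorr₁⟩ := hA π hL ℓ' ι'
  have hirr₁ : ρ₁.toGaloisRep.IsIrreducible :=
    IrreducibleOffSector.isIrreducible_of_reciprocityUpToIrreducibility h22 h23 hRec₀ hcpt hn π hL ι'
      ρ₁ hcorr₁.1
  -- both data read at `v` through `ℓ'`
  have hkey : (Rec.llc v).recGL n (IrrClass.mk πv) = (Rec₀.llc v).recGL n (IrrClass.mk πv) :=
    recGL_eq_of_localGlobalCompatibleAt Rec Rec₀ ι' π.1 ρ₁ hℓ'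
      (hAway n hcpt hn π hL ℓ' ι' ρ₁ hirr₁ hgeo₁ hcorr₁.1 v hℓ') (hcorr₁.2 v) πv hπv
  refine ⟨πv, r, rℂ, hπv, fun h' => absurd hv h', hpst, htr, ?_⟩
  rw [hkey]
  exact hcls

/-- **Registered stub `stub_pairCompatibilityAbove_of_crux` of line `Sketch` (crux stmt-Langlands-14328),
verbatim**: AC (2.2) → AC (2.3) → the crux → the statement of `stub_pairCompatibilityAbove`.
[cite: DeligneAntwerpII1973, §8.4.2] -/
theorem stub_pairCompatibilityAbove_of_crux :
    JacquetShalika1981_partialPairL_boundary_repData → JacquetShalika1981_partialPairL_pole_repData →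
    Summit.Langlands.Langlands.Theses.IrreducibilityBySelfDuality.ReciprocityUpToIrreducibility →
    ∀ (K : Type) [Field K] [NumberField K] (Rec : ReciprocityData K),
      (∀ (n : ℕ) (hcpt : isCompact_glFiniteIntegralLevel n K), 0 < n →
        ∀ (π : CuspidalAutomorphicRepData n K hcpt), π.1.IsLAlgebraic →
          ∀ (ℓ : ℕ) [Fact ℓ.Prime] (ι : PadicAlgCl ℓ ≃+* ℂ) (ρ : FramedGaloisRep K (PadicAlgCl ℓ) n),
            ρ.toGaloisRep.IsIrreducible →
            ((∀ᶠ v : HeightOneSpectrum (𝓞 K) in cofinite, ρ.IsUnramifiedAt v) ∧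
              ∀ (v : HeightOneSpectrum (𝓞 K)) (hv : ((ℓ : ℕ) : 𝓞 K) ∈ v.asIdeal),
                (Literature.NumberTheory.PAdicHodge.fontainePstAdicCompletion v ℓ hv).IsDeRhamFramed
                  (ρ.toLocal v)) →
              (∀ᶠ v : HeightOneSpectrum (𝓞 K) in cofinite, SatakeFrobCompatibleAt ι π.1 ρ v) →
                ∀ v : HeightOneSpectrum (𝓞 K), ((ℓ : ℕ) : 𝓞 K) ∉ v.asIdeal →
                  LocalGlobalCompatibleAt Rec ι π.1 ρ v) →
      ∀ (n : ℕ) (hcpt : isCompact_glFiniteIntegralLevel n K), 0 < n →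
        ∀ (π : CuspidalAutomorphicRepData n K hcpt), π.1.IsLAlgebraic →
          ∀ (ℓ : ℕ) [Fact ℓ.Prime] (ι : PadicAlgCl ℓ ≃+* ℂ) (ρ : FramedGaloisRep K (PadicAlgCl ℓ) n),
            ρ.toGaloisRep.IsIrreducible →
            ((∀ᶠ v : HeightOneSpectrum (𝓞 K) in cofinite, ρ.IsUnramifiedAt v) ∧
              ∀ (v : HeightOneSpectrum (𝓞 K)) (hv : ((ℓ : ℕ) : 𝓞 K) ∈ v.asIdeal),
                (Literature.NumberTheory.PAdicHodge.fontainePstAdicCompletion v ℓ hv).IsDeRhamFramed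
                  (ρ.toLocal v)) →
              (∀ᶠ v : HeightOneSpectrum (𝓞 K) in cofinite, SatakeFrobCompatibleAt ι π.1 ρ v) →
                ∀ v : HeightOneSpectrum (𝓞 K), ((ℓ : ℕ) : 𝓞 K) ∈ v.asIdeal →
                  LocalGlobalCompatibleAt Rec ι π.1 ρ v :=
  pairCompatibilityAbove_of_reciprocityUpToIrreducibility

end Summit

end Summit.Langlands.Langlands.Theorems.ReciprocityUpToIrreducibility

end
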